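import Summits.MatrixMultiplication.MatrixMultiplication.Theorems.TetraDiagonalCore
import Summits.MatrixMultiplication.MatrixMultiplication.Theorems.TetrahedronTensorKronecker
import HarnessLib

/-!
# TetraDiagonalSymm — symmetrisation at a finite level: the three rotated thin tetrahedra multiply
to `T(K₄)`, `R₄(T(K₄)_{d·n²}) ≤ R₄(Z_n^{(d)})³`

(decomp-mm lens 6, generation 19; kernel C1 of NODE-g19, companion of `TetraDiagonal{Core,Ladder,Cover}`;
supports the attacked leaf `TetraFlat` (item 33477) of route `TetrahedronCarving`. No item added/changed.)

OBJECT. The thin-diagonal tetrahedron `Z_n^{(d)} = T_f(K₄)`, `f = (d on the matching {01,23}, n on the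
4-cycle)` (kernel A1, `diagTetra`). CVZ19's symmetrisation step for edge-transitive graphs (§2.1,
`(nonuniformsymm)` in the proof of Thm. 2.1.6), specialised to `K₄` and this weighting: the Kronecker
product of `Z` with its two rotations (thin matching `{02,13}`, resp. `{03,12}` — same 4-rank by the
vertex symmetries `(1 2)`, `(1 3)` of `K₄`) contains `T(K₄)` with `d·n·n` labels on EVERY edge.

RESULTS (sorry-free, over any field):
* `diagTetra_perm₁₂`, `diagTetra_perm₁₃`, `exists_rankOne_decomposition_rot₂/rot₃` — the rotated thin
  tetrahedra are leg/label relabellings of `Z_n^{(d)}`, hence have decompositions of length `R₄(Z)`;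
  `exists_rankOne_decomposition_symm` — the triple product at level `n·(n·n)` has one of length `R₄(Z)³`.
* `tetra_relabel` — injective per-edge relabellings pull `T(K₄)_L` back to `T(K₄)_m`;
  `symm_pullback_apply` — along the per-matching embeddings every thin test sees the small component.
* `tensorRankD_tetra_le_diagTetra_cube` — `R₄(T(K₄)_{d·n²}) ≤ R₄(Z_n^{(d)})³` for `d ≤ n`.
Sources: [corpus:paper-arxiv-1609.07476 p.11–12 (§2.1, `T_f(G)`, (nonuniformsymm), Thm. 2.1.6)].
No `sorry`, no new axiom, no instance, no notation, no definition.
-/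

noncomputable section

set_option linter.dupNamespace false

open Filter Asymptotics Literature.Computability.AlgebraicComplexity
open Summit.MatrixMultiplication.MatrixMultiplication.Theorems.TetrahedronTensor
open Summit.MatrixMultiplication.MatrixMultiplication.Theses.TetrahedronCarving

namespace Summit.MatrixMultiplication.MatrixMultiplication.Theorems.TetraDiagonal

/-! ## §10 Kronecker products of decomposed 4-leg tensors -/

section Kronecker

variable {F : Type*} [Field F]

/-- The Kronecker product of two rank-one sums is the rank-one sum over pairs. [folklore] -/
theorem sum_rankOneTensor_mulK {N M : ℕ} {ι₁ ι₂ : Type*} [Fintype ι₁] [Fintype ι₂]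
    (u₁ : ι₁ → Fin 4 → Fin (N ^ 3) → F) (u₂ : ι₂ → Fin 4 → Fin (M ^ 3) → F) :
    ∑ k : ι₁ × ι₂, rankOneTensor (fun v x => u₁ k.1 v (K₁ x) * u₂ k.2 v (K₂ x)) =
      fun i : Fin 4 → Fin ((N * M) ^ 3) =>
        (∑ k, rankOneTensor (u₁ k)) (fun v => K₁ (i v)) *
          (∑ k, rankOneTensor (u₂ k)) (fun v => K₂ (i v)) := by
  classical
  funext i
  rw [Finset.sum_apply, Fintype.sum_prod_type, Finset.sum_apply, Finset.sum_apply,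
    Finset.sum_mul_sum]
  refine Finset.sum_congr rfl fun k₁ _ => Finset.sum_congr rfl fun k₂ _ => ?_
  simp only [rankOneTensor_apply, ← Finset.prod_mul_distrib]

/-- **Kronecker product of decompositions** (lengths multiply). [folklore] -/
theorem exists_rankOne_decomposition_mulK {N M r s : ℕ} {f : (Fin 4 → Fin (N ^ 3)) → F}
    {g : (Fin 4 → Fin (M ^ 3)) → F} {u₁ : Fin r → Fin 4 → Fin (N ^ 3) → F}
    {u₂ : Fin s → Fin 4 → Fin (M ^ 3) → F} (hu₁ : ∑ k, rankOneTensor (u₁ k) = f)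
    (hu₂ : ∑ k, rankOneTensor (u₂ k) = g) :
    ∃ u : Fin (r * s) → Fin 4 → Fin ((N * M) ^ 3) → F,
      ∑ k, rankOneTensor (u k) = fun i => f (fun v => K₁ (i v)) * g (fun v => K₂ (i v)) := by
  classical
  refine ⟨fun k v x => u₁ (finProdFinEquiv.symm k).1 v (K₁ x) * u₂ (finProdFinEquiv.symm k).2 v (K₂ x),
    ?_⟩
  rw [← hu₁, ← hu₂, ← sum_rankOneTensor_mulK u₁ u₂]
  exact Fintype.sum_equiv finProdFinEquiv.symm _ _ (fun _ => rfl)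

end Kronecker

/-! ## §11 The two rotated thin tetrahedra have the rank of `Z_n^{(d)}` -/

section Rotations

variable {F : Type*} [Field F]

/-- **Vertex symmetry `(1 2)`** (with the induced slot permutations at vertices `0`, `3`) carries
`Z_n^{(d)}` (thin matching `{01,23}`) to the `{02,13}`-thin tetrahedron. [folklore] -/
theorem diagTetra_perm₁₂ (n d : ℕ) (i : Fin 4 → Fin (n ^ 3)) :
    diagTetra F n d
        ![finFunctionFinEquiv ![finFunctionFinEquiv.symm (i 0) 1, finFunctionFinEquiv.symm (i 0) 0,
            finFunctionFinEquiv.symm (i 0) 2],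
          i 2, i 1,
          finFunctionFinEquiv ![finFunctionFinEquiv.symm (i 3) 0, finFunctionFinEquiv.symm (i 3) 2,
            finFunctionFinEquiv.symm (i 3) 1]] =
      thinInd F n d 1 (i 0) * thinInd F n d 2 (i 1) * tetra F n i := by
  have ht : tetra F n
      ![finFunctionFinEquiv ![finFunctionFinEquiv.symm (i 0) 1, finFunctionFinEquiv.symm (i 0) 0,
            finFunctionFinEquiv.symm (i 0) 2],
          i 2, i 1,
          finFunctionFinEquiv ![finFunctionFinEquiv.symm (i 3) 0, finFunctionFinEquiv.symm (i 3) 2,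
            finFunctionFinEquiv.symm (i 3) 1]] = tetra F n i := by
    simp only [tetra]
    refine if_congr ?_ rfl rfl
    simp only [consistent_iff, Matrix.cons_val_zero, Matrix.cons_val_one, Matrix.cons_val_two,
      Matrix.cons_val_three, Matrix.head_cons, Matrix.tail_cons, Equiv.symm_apply_apply]
    constructor
    · rintro ⟨h1, h2, h3, h4, h5, h6⟩
      exact ⟨h2, h1, h3, h4.symm, h6, h5⟩
    · rintro ⟨h1, h2, h3, h4, h5, h6⟩
      exact ⟨h2, h1, h3, h4.symm, h6, h5⟩
  unfold diagTetra
  rw [prod_thinLegs, ht]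
  simp only [thinInd, Matrix.cons_val_zero, Matrix.cons_val_two, Equiv.symm_apply_apply,
    Matrix.head_cons, Matrix.tail_cons]

/-- **Vertex symmetry `(1 3)`**: carries `Z_n^{(d)}` to the thin tetrahedron with thin matching
`{03,12}`. [folklore] -/
theorem diagTetra_perm₁₃ (n d : ℕ) (i : Fin 4 → Fin (n ^ 3)) :
    diagTetra F n d
        ![finFunctionFinEquiv ![finFunctionFinEquiv.symm (i 0) 2, finFunctionFinEquiv.symm (i 0) 1,
            finFunctionFinEquiv.symm (i 0) 0],
          finFunctionFinEquiv ![finFunctionFinEquiv.symm (i 3) 0, finFunctionFinEquiv.symm (i 3) 2,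
            finFunctionFinEquiv.symm (i 3) 1],
          finFunctionFinEquiv ![finFunctionFinEquiv.symm (i 2) 0, finFunctionFinEquiv.symm (i 2) 2,
            finFunctionFinEquiv.symm (i 2) 1],
          finFunctionFinEquiv ![finFunctionFinEquiv.symm (i 1) 0, finFunctionFinEquiv.symm (i 1) 2,
            finFunctionFinEquiv.symm (i 1) 1]] =
      thinInd F n d 2 (i 0) * thinInd F n d 1 (i 2) * tetra F n i := by
  have ht : tetra F n
      ![finFunctionFinEquiv ![finFunctionFinEquiv.symm (i 0) 2, finFunctionFinEquiv.symm (i 0) 1,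
            finFunctionFinEquiv.symm (i 0) 0],
          finFunctionFinEquiv ![finFunctionFinEquiv.symm (i 3) 0, finFunctionFinEquiv.symm (i 3) 2,
            finFunctionFinEquiv.symm (i 3) 1],
          finFunctionFinEquiv ![finFunctionFinEquiv.symm (i 2) 0, finFunctionFinEquiv.symm (i 2) 2,
            finFunctionFinEquiv.symm (i 2) 1],
          finFunctionFinEquiv ![finFunctionFinEquiv.symm (i 1) 0, finFunctionFinEquiv.symm (i 1) 2,
            finFunctionFinEquiv.symm (i 1) 1]] = tetra F n i := by
    simp only [tetra]
    refine if_congr ?_ rfl rfl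
    simp only [consistent_iff, Matrix.cons_val_zero, Matrix.cons_val_one, Matrix.cons_val_two,
      Matrix.cons_val_three, Matrix.head_cons, Matrix.tail_cons, Equiv.symm_apply_apply]
    constructor
    · rintro ⟨h1, h2, h3, h4, h5, h6⟩
      exact ⟨h3, h2, h1, h6.symm, h5.symm, h4.symm⟩
    · rintro ⟨h1, h2, h3, h4, h5, h6⟩
      exact ⟨h3, h2, h1, h6.symm, h5.symm, h4.symm⟩
  unfold diagTetra
  rw [prod_thinLegs, ht]
  simp only [thinInd, Matrix.cons_val_zero, Matrix.cons_val_two, Equiv.symm_apply_apply,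
    Matrix.head_cons, Matrix.tail_cons]

/-- A decomposition of length `R₄(Z_n^{(d)})` of the `{02,13}`-thin tetrahedron. [folklore] -/
theorem exists_rankOne_decomposition_rot₂ (n d : ℕ) :
    ∃ u : Fin (tensorRankD (diagTetra F n d)) → Fin 4 → Fin (n ^ 3) → F,
      ∑ k, rankOneTensor (u k) =
        fun i => thinInd F n d 1 (i 0) * thinInd F n d 2 (i 1) * tetra F n i := by
  classical
  obtain ⟨u, hu⟩ := exists_rankOne_decomposition_diagTetra (F := F) n d
  refine ⟨fun k => ![fun x => u k 0 (finFunctionFinEquiv ![finFunctionFinEquiv.symm x 1,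
      finFunctionFinEquiv.symm x 0, finFunctionFinEquiv.symm x 2]), u k 2, u k 1,
      fun x => u k 3 (finFunctionFinEquiv ![finFunctionFinEquiv.symm x 0,
        finFunctionFinEquiv.symm x 2, finFunctionFinEquiv.symm x 1])], ?_⟩
  funext i
  have hi := congrFun hu
    ![finFunctionFinEquiv ![finFunctionFinEquiv.symm (i 0) 1, finFunctionFinEquiv.symm (i 0) 0,
        finFunctionFinEquiv.symm (i 0) 2],
      i 2, i 1,
      finFunctionFinEquiv ![finFunctionFinEquiv.symm (i 3) 0, finFunctionFinEquiv.symm (i 3) 2,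
        finFunctionFinEquiv.symm (i 3) 1]]
  rw [diagTetra_perm₁₂, Finset.sum_apply] at hi
  rw [← hi, Finset.sum_apply]
  refine Finset.sum_congr rfl fun k _ => ?_
  simp only [rankOneTensor_apply, Fin.prod_univ_four, Matrix.cons_val_zero, Matrix.cons_val_one,
    Matrix.cons_val_two, Matrix.cons_val_three, Matrix.head_cons, Matrix.tail_cons]
  ring

/-- A decomposition of length `R₄(Z_n^{(d)})` of the `{03,12}`-thin tetrahedron. [folklore] -/
theorem exists_rankOne_decomposition_rot₃ (n d : ℕ) :
    ∃ u : Fin (tensorRankD (diagTetra F n d)) → Fin 4 → Fin (n ^ 3) → F,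
      ∑ k, rankOneTensor (u k) =
        fun i => thinInd F n d 2 (i 0) * thinInd F n d 1 (i 2) * tetra F n i := by
  classical
  obtain ⟨u, hu⟩ := exists_rankOne_decomposition_diagTetra (F := F) n d
  refine ⟨fun k => ![fun x => u k 0 (finFunctionFinEquiv ![finFunctionFinEquiv.symm x 2,
      finFunctionFinEquiv.symm x 1, finFunctionFinEquiv.symm x 0]),
      fun x => u k 3 (finFunctionFinEquiv ![finFunctionFinEquiv.symm x 0,
        finFunctionFinEquiv.symm x 2, finFunctionFinEquiv.symm x 1]),
      fun x => u k 2 (finFunctionFinEquiv ![finFunctionFinEquiv.symm x 0,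
        finFunctionFinEquiv.symm x 2, finFunctionFinEquiv.symm x 1]),
      fun x => u k 1 (finFunctionFinEquiv ![finFunctionFinEquiv.symm x 0,
        finFunctionFinEquiv.symm x 2, finFunctionFinEquiv.symm x 1])], ?_⟩
  funext i
  have hi := congrFun hu
    ![finFunctionFinEquiv ![finFunctionFinEquiv.symm (i 0) 2, finFunctionFinEquiv.symm (i 0) 1,
        finFunctionFinEquiv.symm (i 0) 0],
      finFunctionFinEquiv ![finFunctionFinEquiv.symm (i 3) 0, finFunctionFinEquiv.symm (i 3) 2,
        finFunctionFinEquiv.symm (i 3) 1],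
      finFunctionFinEquiv ![finFunctionFinEquiv.symm (i 2) 0, finFunctionFinEquiv.symm (i 2) 2,
        finFunctionFinEquiv.symm (i 2) 1],
      finFunctionFinEquiv ![finFunctionFinEquiv.symm (i 1) 0, finFunctionFinEquiv.symm (i 1) 2,
        finFunctionFinEquiv.symm (i 1) 1]]
  rw [diagTetra_perm₁₃, Finset.sum_apply] at hi
  rw [← hi, Finset.sum_apply]
  refine Finset.sum_congr rfl fun k _ => ?_
  simp only [rankOneTensor_apply, Fin.prod_univ_four, Matrix.cons_val_zero, Matrix.cons_val_one,
    Matrix.cons_val_two, Matrix.cons_val_three, Matrix.head_cons, Matrix.tail_cons]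
  ring

/-- **The symmetrised product** `Z ⊠ Z^{(12)} ⊠ Z^{(13)}` at the level `n·(n·n)` (triple labels, the
`k`-th component thin on the `k`-th perfect matching) has a rank-one decomposition of length
`R₄(Z_n^{(d)})³`. [cite: ChristandlVranaZuiddam2016, §2.1 (nonuniformsymm)] -/
theorem exists_rankOne_decomposition_symm (n d : ℕ) :
    ∃ u : Fin (tensorRankD (diagTetra F n d) *
        (tensorRankD (diagTetra F n d) * tensorRankD (diagTetra F n d))) →
        Fin 4 → Fin ((n * (n * n)) ^ 3) → F,
      ∑ k, rankOneTensor (u k) = fun i =>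
        diagTetra F n d (fun v => K₁ (i v)) *
          (thinInd F n d 1 (K₁ (K₂ (i 0))) * thinInd F n d 2 (K₁ (K₂ (i 1))) *
              tetra F n (fun v => K₁ (K₂ (i v))) *
            (thinInd F n d 2 (K₂ (K₂ (i 0))) * thinInd F n d 1 (K₂ (K₂ (i 2))) *
              tetra F n (fun v => K₂ (K₂ (i v))))) := by
  obtain ⟨u₁, hu₁⟩ := exists_rankOne_decomposition_diagTetra (F := F) n d
  obtain ⟨u₂, hu₂⟩ := exists_rankOne_decomposition_rot₂ (F := F) n d
  obtain ⟨u₃, hu₃⟩ := exists_rankOne_decomposition_rot₃ (F := F) n d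
  obtain ⟨u₂₃, hu₂₃⟩ := exists_rankOne_decomposition_mulK hu₂ hu₃
  exact exists_rankOne_decomposition_mulK hu₁ hu₂₃

end Rotations

/-! ## §12 Relabelling and the embedding `T(K₄)_{d·n²} ↪ Z ⊠ Z^{(12)} ⊠ Z^{(13)}` -/

section Relabel

variable {F : Type*} [Field F]

/-- **Per-edge relabelling**: injective relabellings `ι_e` of the six edge label sets (applied at both
endpoints; slot `(v,j)` belongs to edge `vertexLabels id v j`) do not change the tetrahedron tensor's
entries. [folklore] -/
theorem tetra_relabel {m L : ℕ} (ι : Fin 6 → Fin m → Fin L) (hι : ∀ k, Function.Injective (ι k))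
    (i : Fin 4 → Fin (m ^ 3)) :
    tetra F L (fun v => finFunctionFinEquiv fun j =>
        ι (vertexLabels (fun k : Fin 6 => k) v j) (finFunctionFinEquiv.symm (i v) j)) =
      tetra F m i := by
  simp only [tetra, Equiv.symm_apply_apply]
  refine if_congr ?_ rfl rfl
  simp only [consistent_iff, vertexLabels, Matrix.cons_val_zero, Matrix.cons_val_one,
    Matrix.cons_val_two, Matrix.cons_val_three, Matrix.head_cons, Matrix.tail_cons, (hι _).eq_iff]

/-- Slots of a `K₁`-projection. -/
theorem symm_K₁_apply {N M : ℕ} (x : Fin ((N * M) ^ 3)) (j : Fin 3) :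
    finFunctionFinEquiv.symm (K₁ x) j = (finProdFinEquiv.symm (finFunctionFinEquiv.symm x j)).1 := by
  simp only [K₁, Equiv.symm_apply_apply]

/-- Slots of a `K₂`-projection. -/
theorem symm_K₂_apply {N M : ℕ} (x : Fin ((N * M) ^ 3)) (j : Fin 3) :
    finFunctionFinEquiv.symm (K₂ x) j = (finProdFinEquiv.symm (finFunctionFinEquiv.symm x j)).2 := by
  simp only [K₂, Equiv.symm_apply_apply]

/-- A thin indicator equals `1` as soon as the tested label is numerically `< d`. -/
theorem thinInd_eq_one {n d : ℕ} {j : Fin 3} {x : Fin (n ^ 3)}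
    (h : ((finFunctionFinEquiv.symm x j : Fin n) : ℕ) < d) : thinInd F n d j x = 1 := by
  simp only [thinInd, if_pos h]

/-- **The embedding, pointwise.** With the per-matching label embeddings
`ι₁ (a,(b,c)) = (a,(b,c))`, `ι₂ (a,(b,c)) = (b,(a,c))`, `ι₃ (a,(b,c)) = (b,(c,a))` (`a < d` cast into
`Fin n`; edges `01,02,03,12,13,23` in matchings `1,2,3,3,2,1`), the symmetrised product pulled back along
the induced leg maps is `T(K₄)_{d·n·n}`: every thin test sees the component `a < d`, and the three
tetrahedron factors recombine (`tetra_mul_apply`, `tetra_relabel`).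
[cite: ChristandlVranaZuiddam2016, §2.1 (nonuniformsymm)] -/
theorem symm_pullback_apply {n d : ℕ}
    (ι : Fin 6 → Fin (d * (n * n)) → Fin (n * (n * n)))
    (hι : ∀ k, Function.Injective (ι k))
    (h01 : ∀ y, (((finProdFinEquiv.symm (ι 0 y)).1 : Fin n) : ℕ) < d)
    (h23 : ∀ y, (((finProdFinEquiv.symm (ι 5 y)).1 : Fin n) : ℕ) < d)
    (h02 : ∀ y, (((finProdFinEquiv.symm (finProdFinEquiv.symm (ι 1 y)).2).1 : Fin n) : ℕ) < d)
    (h13 : ∀ y, (((finProdFinEquiv.symm (finProdFinEquiv.symm (ι 4 y)).2).1 : Fin n) : ℕ) < d)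
    (h03 : ∀ y, (((finProdFinEquiv.symm (finProdFinEquiv.symm (ι 2 y)).2).2 : Fin n) : ℕ) < d)
    (h12 : ∀ y, (((finProdFinEquiv.symm (finProdFinEquiv.symm (ι 3 y)).2).2 : Fin n) : ℕ) < d)
    (i : Fin 4 → Fin ((d * (n * n)) ^ 3)) :
    (fun x : Fin 4 → Fin ((n * (n * n)) ^ 3) =>
        diagTetra F n d (fun v => K₁ (x v)) *
          (thinInd F n d 1 (K₁ (K₂ (x 0))) * thinInd F n d 2 (K₁ (K₂ (x 1))) *
              tetra F n (fun v => K₁ (K₂ (x v))) *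
            (thinInd F n d 2 (K₂ (K₂ (x 0))) * thinInd F n d 1 (K₂ (K₂ (x 2))) *
              tetra F n (fun v => K₂ (K₂ (x v))))))
        (fun v => finFunctionFinEquiv fun j =>
          ι (vertexLabels (fun k : Fin 6 => k) v j) (finFunctionFinEquiv.symm (i v) j)) =
      tetra F (d * (n * n)) i := by
  -- the six thin tests all see the small component
  have e01 : thinInd F n d 0 (K₁ (finFunctionFinEquiv fun j =>
      ι (vertexLabels (fun k : Fin 6 => k) 0 j) (finFunctionFinEquiv.symm (i 0) j))) = 1 := by
    refine thinInd_eq_one (F := F) ?_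
    rw [symm_K₁_apply, Equiv.symm_apply_apply]
    exact h01 _
  have e23 : thinInd F n d 2 (K₁ (finFunctionFinEquiv fun j =>
      ι (vertexLabels (fun k : Fin 6 => k) 2 j) (finFunctionFinEquiv.symm (i 2) j))) = 1 := by
    refine thinInd_eq_one (F := F) ?_
    rw [symm_K₁_apply, Equiv.symm_apply_apply]
    exact h23 _
  have e02 : thinInd F n d 1 (K₁ (K₂ (finFunctionFinEquiv fun j =>
      ι (vertexLabels (fun k : Fin 6 => k) 0 j) (finFunctionFinEquiv.symm (i 0) j)))) = 1 := by
    refine thinInd_eq_one (F := F) ?_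
    rw [symm_K₁_apply, symm_K₂_apply, Equiv.symm_apply_apply]
    exact h02 _
  have e13 : thinInd F n d 2 (K₁ (K₂ (finFunctionFinEquiv fun j =>
      ι (vertexLabels (fun k : Fin 6 => k) 1 j) (finFunctionFinEquiv.symm (i 1) j)))) = 1 := by
    refine thinInd_eq_one (F := F) ?_
    rw [symm_K₁_apply, symm_K₂_apply, Equiv.symm_apply_apply]
    exact h13 _
  have e03 : thinInd F n d 2 (K₂ (K₂ (finFunctionFinEquiv fun j =>
      ι (vertexLabels (fun k : Fin 6 => k) 0 j) (finFunctionFinEquiv.symm (i 0) j)))) = 1 := by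
    refine thinInd_eq_one (F := F) ?_
    rw [symm_K₂_apply, symm_K₂_apply, Equiv.symm_apply_apply]
    exact h03 _
  have e12 : thinInd F n d 1 (K₂ (K₂ (finFunctionFinEquiv fun j =>
      ι (vertexLabels (fun k : Fin 6 => k) 2 j) (finFunctionFinEquiv.symm (i 2) j)))) = 1 := by
    refine thinInd_eq_one (F := F) ?_
    rw [symm_K₂_apply, symm_K₂_apply, Equiv.symm_apply_apply]
    exact h12 _
  have hrel := tetra_relabel (F := F) ι hι i
  have hm₁ := tetra_mul_apply (F := F) (N := n) (M := n * n) (fun v => finFunctionFinEquiv fun j =>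
      ι (vertexLabels (fun k : Fin 6 => k) v j) (finFunctionFinEquiv.symm (i v) j))
  have hm₂ := tetra_mul_apply (F := F) (N := n) (M := n) (fun v => K₂ (finFunctionFinEquiv fun j =>
      ι (vertexLabels (fun k : Fin 6 => k) v j) (finFunctionFinEquiv.symm (i v) j)))
  simp only []
  rw [diagTetra, prod_thinLegs, e01, e23, e02, e13, e03, e12, ← hrel, hm₁, hm₂]
  ring

/-- **Symmetrisation at a finite level** (CVZ19 (nonuniformsymm) for `K₄` and the weighting
`(d; n, n)`): `R₄(T(K₄)_{d·n·n}) ≤ R₄(Z_n^{(d)})³` for `d ≤ n`.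
[cite: ChristandlVranaZuiddam2016, §2.1 (nonuniformsymm)] -/
theorem tensorRankD_tetra_le_diagTetra_cube {n d : ℕ} (hd : d ≤ n) :
    tensorRankD (tetra F (d * (n * n))) ≤ tensorRankD (diagTetra F n d) ^ 3 := by
  classical
  obtain ⟨u, hu⟩ := exists_rankOne_decomposition_symm (F := F) n d
  -- the three per-matching label embeddings `Fin (d·(n·n)) ↪ Fin (n·(n·n))`, by edge
  let ι : Fin 6 → Fin (d * (n * n)) → Fin (n * (n * n)) :=
    ![fun y => finProdFinEquiv (Fin.castLE hd (finProdFinEquiv.symm y).1, (finProdFinEquiv.symm y).2),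
      fun y => finProdFinEquiv ((finProdFinEquiv.symm (finProdFinEquiv.symm y).2).1,
        finProdFinEquiv (Fin.castLE hd (finProdFinEquiv.symm y).1,
          (finProdFinEquiv.symm (finProdFinEquiv.symm y).2).2)),
      fun y => finProdFinEquiv ((finProdFinEquiv.symm (finProdFinEquiv.symm y).2).1,
        finProdFinEquiv ((finProdFinEquiv.symm (finProdFinEquiv.symm y).2).2,
          Fin.castLE hd (finProdFinEquiv.symm y).1)),
      fun y => finProdFinEquiv ((finProdFinEquiv.symm (finProdFinEquiv.symm y).2).1,
        finProdFinEquiv ((finProdFinEquiv.symm (finProdFinEquiv.symm y).2).2,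
          Fin.castLE hd (finProdFinEquiv.symm y).1)),
      fun y => finProdFinEquiv ((finProdFinEquiv.symm (finProdFinEquiv.symm y).2).1,
        finProdFinEquiv (Fin.castLE hd (finProdFinEquiv.symm y).1,
          (finProdFinEquiv.symm (finProdFinEquiv.symm y).2).2)),
      fun y => finProdFinEquiv (Fin.castLE hd (finProdFinEquiv.symm y).1, (finProdFinEquiv.symm y).2)]
  have hinj₁ : Function.Injective (fun y : Fin (d * (n * n)) =>
      finProdFinEquiv (Fin.castLE hd (finProdFinEquiv.symm y).1, (finProdFinEquiv.symm y).2)) := by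
    intro y y' h
    simp only [Equiv.apply_eq_iff_eq, Prod.mk.injEq] at h
    obtain ⟨h1, h2⟩ := h
    exact finProdFinEquiv.symm.injective (Prod.ext (Fin.castLE_injective hd h1) h2)
  have hinj₂ : Function.Injective (fun y : Fin (d * (n * n)) =>
      finProdFinEquiv ((finProdFinEquiv.symm (finProdFinEquiv.symm y).2).1,
        finProdFinEquiv (Fin.castLE hd (finProdFinEquiv.symm y).1,
          (finProdFinEquiv.symm (finProdFinEquiv.symm y).2).2))) := by
    intro y y' h
    simp only [Equiv.apply_eq_iff_eq, Prod.mk.injEq] at h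
    obtain ⟨h1, h2, h3⟩ := h
    have h13 : (finProdFinEquiv.symm y).2 = (finProdFinEquiv.symm y').2 :=
      finProdFinEquiv.symm.injective (Prod.ext h1 h3)
    exact finProdFinEquiv.symm.injective (Prod.ext (Fin.castLE_injective hd h2) h13)
  have hinj₃ : Function.Injective (fun y : Fin (d * (n * n)) =>
      finProdFinEquiv ((finProdFinEquiv.symm (finProdFinEquiv.symm y).2).1,
        finProdFinEquiv ((finProdFinEquiv.symm (finProdFinEquiv.symm y).2).2,
          Fin.castLE hd (finProdFinEquiv.symm y).1))) := by
    intro y y' h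
    simp only [Equiv.apply_eq_iff_eq, Prod.mk.injEq] at h
    obtain ⟨h1, h2, h3⟩ := h
    have h12 : (finProdFinEquiv.symm y).2 = (finProdFinEquiv.symm y').2 :=
      finProdFinEquiv.symm.injective (Prod.ext h1 h2)
    exact finProdFinEquiv.symm.injective (Prod.ext (Fin.castLE_injective hd h3) h12)
  have hι : ∀ k, Function.Injective (ι k) := fun k => by fin_cases k <;> assumption
  have hlt : ∀ y : Fin (d * (n * n)), ((Fin.castLE hd (finProdFinEquiv.symm y).1 : Fin n) : ℕ) < d :=
    fun y => by rw [Fin.val_castLE]; exact (finProdFinEquiv.symm y).1.isLt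
  have key := funext (symm_pullback_apply (F := F) ι hι
    (fun y => by simp only [ι, Matrix.cons_val_zero, Equiv.symm_apply_apply]; exact hlt y)
    (fun y => by simp only [ι, Matrix.cons_val, Equiv.symm_apply_apply]; exact hlt y)
    (fun y => by simp only [ι, Matrix.cons_val_one, Matrix.cons_val_zero, Equiv.symm_apply_apply]
                 exact hlt y)
    (fun y => by simp only [ι, Matrix.cons_val, Equiv.symm_apply_apply]; exact hlt y)
    (fun y => by simp only [ι, Matrix.cons_val_two, Matrix.head_cons, Matrix.tail_cons,
      Equiv.symm_apply_apply]; exact hlt y)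
    (fun y => by simp only [ι, Matrix.cons_val_three, Matrix.head_cons, Matrix.tail_cons,
      Equiv.symm_apply_apply]; exact hlt y))
  rw [← key]
  refine (tensorRankD_pullback_le _
    (fun v x => finFunctionFinEquiv fun j =>
      ι (vertexLabels (fun k : Fin 6 => k) v j) (finFunctionFinEquiv.symm x j))
    ⟨_, fun k => rankOneTensor (u k), fun k => rankOneTensor_mem _, hu⟩).trans ?_
  calc tensorRankD _
      ≤ tensorRankD (diagTetra F n d) * (tensorRankD (diagTetra F n d) * tensorRankD (diagTetra F n d)) :=
        tensorRankD_le_of_eq_sum u hu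
    _ = tensorRankD (diagTetra F n d) ^ 3 := by ring

end Relabel

end Summit.MatrixMultiplication.MatrixMultiplication.Theorems.TetraDiagonal

end
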